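/-
Copyright: cell pub-balaban-gaps, seat ne8 (estimate NE7c), gen 12. Project licence.
-/
import Summits.QuantumFields.BalabanUV.T4Continuum.Spine.NE7b.ConvexWindowMassLocal

/-!
# Road (δ) on the convexity road's WINDOW-MASS letter: the OWNER's `ballMass_ge_of_pinch` and the leaf `ballMass_ge_of_localPinch`
# READ AT A LIVE RADIUS — the fraction `η` at the LOWERED radius `λ₀R`, LOSS × λ₀² in the Gaussian exponent, ONE letter for the grid
# (row NE7c; junction J-11)

Cell `pub-balaban-gaps` (G2), seat ne8, estimate **NE7c** (`T4IndicatorShell.ShellWeightBound`; two-run artefact, NOT PRINTED in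
[Bałaban 1983–89], NOT PROVED).  Twenty-fifth proof-only file under `Spine/NE7c/`: the convexity road's `hmass` letter
(`…ConvexTiltMoment.exp_moment_le_of_uniformlyConvex_window`: «the window carries the fraction `1 − η` of the tilted mass») as SUPPLIED by
the OWNER t4-ne7b-p1 g106's `Spine/NE7b/ConvexWindowMass` (two-sided pinch at the minimiser) and by `ConvexWindowMassLocal` (upper
pinch on the ball only), consumed BY NAME; imports `ConvexWindowMassLocal` only (it carries the OWNER's file); nothing of Bałaban's is
named; no `def`; 0 `sorry`.

THE QUESTION (seat census `HOME/ne/NE7c.md`, NEW row 45).  The window of the convexity road is a small-field window of the creation step;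
road (δ) lowers its per-bond radius by a live factor `s ∈ [λ₀, 1]`, so the ball about the minimiser that the window contains has radius
`s·R` instead of `R`.  The mass fraction OUTSIDE the ball, `η(R) = e^{−λR²∕4}(π∕(λ∕4))^{d∕2}∕(π∕(Λ∕2))^{d∕2}`, is a LOWER-bound use of the
window (the second one on the (R2′) roads after the compact fibre's volume letter, file 24): it can only lose.  By how much, and is the
delivered letter assignment-free?

WHAT IS PROVED ([folklore]; the two suppliers BY NAME at the radius `λ₀R`, then monotonicity of the ball integral in the radius):
* §1 `ballIntegral_mono_radius` (`0 ≤ e^{−V}` integrable ⊢ `r ≤ r′ → ∫_{‖y−x₀‖<r} e^{−V} ≤ ∫_{‖y−x₀‖<r′} e^{−V}`).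
* §2 **`ballMass_ge_of_pinch_live`**: two-sided pinch at `x₀`, `0 ≤ λ₀ ≤ s`, `0 ≤ R` ⊢
  `(1 − η(λ₀R))·∫e^{−V} ≤ ∫_{‖y−x₀‖ < sR} e^{−V}` for EVERY live factor `s` — ONE fraction for the grid, print's `η` at the LOWERED radius:
  exponent `λ(λ₀R)²∕4 = λ₀²·(λR²∕4)` (`eta_exponent_live`), i.e. LOSS × λ₀² in the Gaussian tail exponent, prefactors untouched — the pattern
  of file 17's lowered-threshold Gaussian tail and of file 19's near-threshold letters (class C8∕C1).
* §3 **`ballMass_ge_of_localPinch_live`**: the leaf's LOCAL version needs the upper pinch only on the ball of radius `λ₀R` (WEAKER than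
  print's radius-`R` pinch: `upperPinch_mono_radius`) and the displayed positivity at `λ₀R`; conclusion with `η_loc(λ₀R)` for every `s ≥ λ₀`.
* §4 reading aid `eta_exponent_live` and a decided toy.  (The minimiser `x₀` of the suppliers does not see the window, so the SAME centre
  serves every assignment; `ConvexMinimiserBall.exists_ballMass_ge_of_firstOrder_pinch` at the radius `λ₀R` followed by §1 gives the
  `∃ x₀` form — not restated here.)

CENSUS (row 45, NEW; `HOME/ne/NE7c.md` §19): the convexity road's window-mass letter at a lowered window costs LOSS × λ₀² in the exponent
`λR²∕4` of the excluded Gaussian tail, assignment-free, identical under (δ-1) and (δ-global…) (single-level letter); it bites only through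
the requirement `η(λ₀R) < 1`, i.e. `λ₀²·λR²∕4 > (d∕2)·log(2Λ∕λ) `-type largeness of the window radius in units of the convexity scale —
print's radius `R = R(g_j)` in those units GROWS along the flow (the windows are `p(g_j)`-multiples of the fluctuation scale), so the row is
MILD (class C8, with file 2's `restrictedMass_lower_live`).  BY-NAME EFFECT ON THE WALL: none (junction ∕ census file).

NOT HERE (honest): the pinch constants `λ, Λ` and the radius `R(g_j)` for Bałaban's exponents ((A1c) readings — the suppliers' own
NOT-HERE lists apply verbatim); node O; NE7c.  VERDICT WORD UNCHANGED: WORK-bound behind node O; INSTANCE 0∕1.  NE7c ∕ NE7b NOT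
PRINTED ∕ NOT PROVED; spine 0∕9; one finite T⁴ — NOT ℝ⁴, NOT infinite volume, NOT the mass gap, NOT Clay.
HONEST DEPENDENCY (cell): continuum YM on T⁴ ⇐ BetaPertH ∧ nine spine estimates (0∕9 proved); BetaPertH ⇐ (D1) ∧ (D4) ∧ CAP+tail.
-/

set_option autoImplicit false

noncomputable section

open MeasureTheory Real
open scoped RealInnerProductSpace
open Summit.QuantumFields.BalabanUV.T4Continuum.NE7b

namespace Summit.QuantumFields.BalabanUV.T4Continuum.Spine.NE7c.LiveFactorWindowMass

variable {n : ℕ}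

/-! ## §1 Monotonicity of the ball integral in the radius -/

/-- The ball integral of `e^{−V}` (integrable) is monotone in the radius. [folklore] -/
theorem ballIntegral_mono_radius {V : EuclideanSpace ℝ (Fin n) → ℝ} (hZ : Integrable fun y => exp (-V y))
    (x₀ : EuclideanSpace ℝ (Fin n)) {r r' : ℝ} (hrr' : r ≤ r') :
    ∫ y in {y | ‖y - x₀‖ < r}, exp (-V y) ≤ ∫ y in {y | ‖y - x₀‖ < r'}, exp (-V y) := by
  refine setIntegral_mono_set hZ.integrableOn ?_ ?_
  · exact Filter.Eventually.of_forall fun y => (exp_pos _).le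
  · exact Filter.Eventually.of_forall fun y (hy : ‖y - x₀‖ < r) => show ‖y - x₀‖ < r' from hy.trans_le hrr'

/-- An upper pinch on the ball of radius `R` is an upper pinch on every smaller ball (`r ≤ R`). [folklore] -/
theorem upperPinch_mono_radius {V : EuclideanSpace ℝ (Fin n) → ℝ} {Lam R r : ℝ} {x₀ : EuclideanSpace ℝ (Fin n)} (hrR : r ≤ R)
    (hup : ∀ y, ‖y - x₀‖ < R → V y ≤ V x₀ + Lam / 2 * ‖y - x₀‖ ^ 2) :
    ∀ y, ‖y - x₀‖ < r → V y ≤ V x₀ + Lam / 2 * ‖y - x₀‖ ^ 2 :=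
  fun y hy => hup y (hy.trans_le hrR)

/-! ## §2 The OWNER's two-sided pinch at a live radius: ONE fraction `η(λ₀R)` for the grid -/

/-- **THE WINDOW-MASS LETTER AT A LIVE RADIUS, ASSIGNMENT-FREE.**  The OWNER's `ballMass_ge_of_pinch` at the LOWERED radius `λ₀R`, then
monotonicity in the radius: for every live factor `s ≥ λ₀ ≥ 0`,
`(1 − e^{−λ(λ₀R)²∕4}(π∕(λ∕4))^{d∕2}∕(π∕(Λ∕2))^{d∕2})·∫e^{−V} ≤ ∫_{‖y−x₀‖ < sR} e^{−V}`. [folklore] -/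
theorem ballMass_ge_of_pinch_live {V : EuclideanSpace ℝ (Fin n) → ℝ} {lam Lam R lam0 s : ℝ} (hlam : 0 < lam) (hLam : 0 < Lam)
    (hR : 0 ≤ R) (h0 : 0 ≤ lam0) (hs : lam0 ≤ s)
    (x₀ : EuclideanSpace ℝ (Fin n)) (hlow : ∀ y, V x₀ + lam / 2 * ‖y - x₀‖ ^ 2 ≤ V y)
    (hup : ∀ y, V y ≤ V x₀ + Lam / 2 * ‖y - x₀‖ ^ 2) (hZ : Integrable fun y => exp (-V y)) :
    (1 - exp (-(lam * (lam0 * R) ^ 2 / 4)) * (π / (lam / 4)) ^ (Module.finrank ℝ (EuclideanSpace ℝ (Fin n)) / 2 : ℝ) /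
        (π / (Lam / 2)) ^ (Module.finrank ℝ (EuclideanSpace ℝ (Fin n)) / 2 : ℝ)) * ∫ y, exp (-V y) ≤
      ∫ y in {y | ‖y - x₀‖ < s * R}, exp (-V y) :=
  (ConvexWindowMass.ballMass_ge_of_pinch hlam hLam (mul_nonneg h0 hR) x₀ hlow hup hZ).trans
    (ballIntegral_mono_radius hZ x₀ (mul_le_mul_of_nonneg_right hs hR))

/-! ## §3 The leaf's LOCAL pinch at a live radius: the upper pinch is needed on the ball of radius `λ₀R` only -/

/-- **THE LOCAL WINDOW-MASS LETTER AT A LIVE RADIUS.**  `ConvexWindowMassLocal.ballMass_ge_of_localPinch` at the LOWERED radius `λ₀R`: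
lower pinch everywhere, upper pinch on `‖y − x₀‖ < λ₀R` ONLY, displayed positivity at `λ₀R`; then for every live factor `s ≥ λ₀ ≥ 0`
`(1 − η_loc(λ₀R))·∫e^{−V} ≤ ∫_{‖y−x₀‖ < sR} e^{−V}`. [folklore] -/
theorem ballMass_ge_of_localPinch_live {V : EuclideanSpace ℝ (Fin n) → ℝ} {lam Lam R lam0 s : ℝ} (hlam : 0 < lam) (hLam : 0 < Lam)
    (hR : 0 ≤ R) (h0 : 0 ≤ lam0) (hs : lam0 ≤ s)
    (x₀ : EuclideanSpace ℝ (Fin n)) (hlow : ∀ y, V x₀ + lam / 2 * ‖y - x₀‖ ^ 2 ≤ V y)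
    (hup : ∀ y, ‖y - x₀‖ < lam0 * R → V y ≤ V x₀ + Lam / 2 * ‖y - x₀‖ ^ 2) (hZ : Integrable fun y => exp (-V y))
    (hΛR : exp (-(Lam * (lam0 * R) ^ 2 / 4)) * (π / (Lam / 4)) ^ (Module.finrank ℝ (EuclideanSpace ℝ (Fin n)) / 2 : ℝ) <
      (π / (Lam / 2)) ^ (Module.finrank ℝ (EuclideanSpace ℝ (Fin n)) / 2 : ℝ)) :
    (1 - exp (-(lam * (lam0 * R) ^ 2 / 4)) * (π / (lam / 4)) ^ (Module.finrank ℝ (EuclideanSpace ℝ (Fin n)) / 2 : ℝ) /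
        ((π / (Lam / 2)) ^ (Module.finrank ℝ (EuclideanSpace ℝ (Fin n)) / 2 : ℝ) -
          exp (-(Lam * (lam0 * R) ^ 2 / 4)) * (π / (Lam / 4)) ^ (Module.finrank ℝ (EuclideanSpace ℝ (Fin n)) / 2 : ℝ))) *
        ∫ y, exp (-V y) ≤
      ∫ y in {y | ‖y - x₀‖ < s * R}, exp (-V y) :=
  (ConvexWindowMassLocal.ballMass_ge_of_localPinch hlam hLam (mul_nonneg h0 hR) x₀ hlow hup hZ hΛR).trans
    (ballIntegral_mono_radius hZ x₀ (mul_le_mul_of_nonneg_right hs hR))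

/-- The same with print's upper pinch on the FULL radius `R` (`λ₀ ≤ 1`): it restricts to the ball of radius `λ₀R`. [folklore] -/
theorem ballMass_ge_of_localPinch_live' {V : EuclideanSpace ℝ (Fin n) → ℝ} {lam Lam R lam0 s : ℝ} (hlam : 0 < lam) (hLam : 0 < Lam)
    (hR : 0 ≤ R) (h0 : 0 ≤ lam0) (h1 : lam0 ≤ 1) (hs : lam0 ≤ s)
    (x₀ : EuclideanSpace ℝ (Fin n)) (hlow : ∀ y, V x₀ + lam / 2 * ‖y - x₀‖ ^ 2 ≤ V y)
    (hup : ∀ y, ‖y - x₀‖ < R → V y ≤ V x₀ + Lam / 2 * ‖y - x₀‖ ^ 2) (hZ : Integrable fun y => exp (-V y))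
    (hΛR : exp (-(Lam * (lam0 * R) ^ 2 / 4)) * (π / (Lam / 4)) ^ (Module.finrank ℝ (EuclideanSpace ℝ (Fin n)) / 2 : ℝ) <
      (π / (Lam / 2)) ^ (Module.finrank ℝ (EuclideanSpace ℝ (Fin n)) / 2 : ℝ)) :
    (1 - exp (-(lam * (lam0 * R) ^ 2 / 4)) * (π / (lam / 4)) ^ (Module.finrank ℝ (EuclideanSpace ℝ (Fin n)) / 2 : ℝ) /
        ((π / (Lam / 2)) ^ (Module.finrank ℝ (EuclideanSpace ℝ (Fin n)) / 2 : ℝ) -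
          exp (-(Lam * (lam0 * R) ^ 2 / 4)) * (π / (Lam / 4)) ^ (Module.finrank ℝ (EuclideanSpace ℝ (Fin n)) / 2 : ℝ))) *
        ∫ y, exp (-V y) ≤
      ∫ y in {y | ‖y - x₀‖ < s * R}, exp (-V y) :=
  ballMass_ge_of_localPinch_live hlam hLam hR h0 hs x₀ hlow
    (upperPinch_mono_radius (by simpa using mul_le_mul_of_nonneg_right h1 hR) hup) hZ hΛR

/-! ## §4 Reading aid and sanity -/

/-- **LOSS × λ₀² IN THE EXPONENT**: the live fraction's Gaussian exponent is print's times `λ₀²` — `λ(λ₀R)²∕4 = λ₀²·(λR²∕4)`. [folklore] -/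
theorem eta_exponent_live (lam lam0 R : ℝ) : lam * (lam0 * R) ^ 2 / 4 = lam0 ^ 2 * (lam * R ^ 2 / 4) := by ring

/-- Decided toy: at `λ₀ = 1∕2` the exponent keeps exactly one quarter of print's. -/
example (lam R : ℝ) : lam * ((1 / 2 : ℝ) * R) ^ 2 / 4 = (1 / 4 : ℝ) * (lam * R ^ 2 / 4) := by ring

end Summit.QuantumFields.BalabanUV.T4Continuum.Spine.NE7c.LiveFactorWindowMass

end
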